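import Mathlib
import HarnessLib
import Summits.ValiantsHypothesis.ValiantsHypothesis.Theses.MonotoneRestoration
import Literature.Computability.AlgebraicComplexity.ArithCircuit
import Literature.Computability.AlgebraicComplexity.ArithCircuitProofs
import Literature.Computability.AlgebraicComplexity.MonotoneStructure
import Literature.Computability.AlgebraicComplexity.PermanentIrreducible
import Literature.ModelTheory.FiniteModelTheory.CkEquiv
import Summits.ValiantsHypothesis.ValiantsHypothesis.Theorems.MonotoneRestorationMonotoneRestorationQPCosetCount
import Summits.ValiantsHypothesis.ValiantsHypothesis.Theorems.MonotoneRestorationMonotoneRestorationQPSymmetricLB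
import Summits.ValiantsHypothesis.ValiantsHypothesis.Theorems.MonotoneRestorationMonotoneRestorationQPSupportSymmetrisation
import Summits.ValiantsHypothesis.ValiantsHypothesis.Theorems.MonotoneRestorationMonotoneRestorationQPSparseRegime
import Summits.ValiantsHypothesis.ValiantsHypothesis.Theorems.MonotoneRestorationMonotoneRestorationQPBeta
import Literature.Computability.AlgebraicComplexity.SymmetricArithCircuit
import Literature.Computability.AlgebraicComplexity.DawarWilsenach2025Proofs
import Literature.GroupTheory.PermutationGroups.SmallIndexSubgroups
import Summits.ValiantsHypothesis.ValiantsHypothesis.Theorems.MonotoneRestorationQP.Negative.LoadBearing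
import Summits.ValiantsHypothesis.ValiantsHypothesis.Theorems.MonotoneRestorationMonotoneRestorationQPPermSupportCount

/-! TTRL-lite variant V18956 of stmt-ValiantsHypothesis-15886 -/

-- `Summit.ValiantsHypothesis.ValiantsHypothesis.…` is the tree's mandated single-conjunct layout
-- (Sub = Summit), so the duplicated namespace component is intended.
set_option linter.dupNamespace false

namespace Summit.ValiantsHypothesis.ValiantsHypothesis.Theorems

open Summit.ValiantsHypothesis.ValiantsHypothesis.Theses.MonotoneRestoration
open Literature.Computability.AlgebraicComplexity

/-- TTRL-lite variant V18956 (`drop_hyp`: the side condition `h ≠ h'` of part 2 of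
`stub_mulGate_children_extend` is dropped, so cross terms of the SAME factor are demanded) is FALSE.
Witness: `n = 1`, `p = f = X (0,0)`, `q = 1`, `m = m' = Finsupp.single (0,0) 1`; the product
`p * q = X (0,0)` extends into `f` with `μ = 0`, but `m + m' + μ` has exponent `≥ 2` at `(0,0)` while
the unique monomial of `f` has exponent `1` there.  Pins that `h ≠ h'` is load-bearing. -/
theorem stub_mulGate_children_extend_var18956_false :
    ¬ (∀ (n : ℕ) (p q f : MvPolynomial (Fin n × Fin n) NNReal), p * q ≠ 0 →
        (∃ μ : (Fin n × Fin n) →₀ ℕ, ∀ m ∈ (p * q).support, m + μ ∈ f.support) →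
        ∀ m ∈ p.support, ∀ m' ∈ p.support,
          ∃ μ : (Fin n × Fin n) →₀ ℕ, m + m' + μ ∈ f.support) := by
  intro h
  have hX : (Finsupp.single ((0 : Fin 1), (0 : Fin 1)) 1 : Fin 1 × Fin 1 →₀ ℕ) ∈
      (MvPolynomial.X ((0 : Fin 1), (0 : Fin 1)) : MvPolynomial (Fin 1 × Fin 1) NNReal).support := by
    rw [MvPolynomial.support_X]
    exact Finset.mem_singleton_self _
  have hne : (MvPolynomial.X ((0 : Fin 1), (0 : Fin 1)) : MvPolynomial (Fin 1 × Fin 1) NNReal) * 1 ≠ 0 := by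
    rw [mul_one]
    exact MvPolynomial.X_ne_zero _
  have hext : ∃ μ : (Fin 1 × Fin 1) →₀ ℕ,
      ∀ m ∈ ((MvPolynomial.X ((0 : Fin 1), (0 : Fin 1)) : MvPolynomial (Fin 1 × Fin 1) NNReal) * 1).support,
        m + μ ∈ (MvPolynomial.X ((0 : Fin 1), (0 : Fin 1)) : MvPolynomial (Fin 1 × Fin 1) NNReal).support := by
    refine ⟨0, fun m hm => ?_⟩
    rw [mul_one] at hm
    rwa [add_zero]
  obtain ⟨μ, hμ⟩ := h 1 (MvPolynomial.X ((0 : Fin 1), (0 : Fin 1))) 1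
    (MvPolynomial.X ((0 : Fin 1), (0 : Fin 1))) hne hext _ hX _ hX
  rw [MvPolynomial.support_X, Finset.mem_singleton] at hμ
  have h2 := congrArg (fun g : Fin 1 × Fin 1 →₀ ℕ => g ((0 : Fin 1), (0 : Fin 1))) hμ
  simp only [Finsupp.add_apply, Finsupp.single_eq_same] at h2
  omega

end Summit.ValiantsHypothesis.ValiantsHypothesis.Theorems
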